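import Literature.NumberTheory.EllipticCurves.KummerUnramified
import HarnessLib

/-!
# The Kummer character of a uniformizer is onto the roots of unity on the inertia group

`Proofs` file (theorems only, no definitions, no named facts), topic `NumberTheory/EllipticCurves`;
companion of `KummerUnramified` (`dvd_log_valuation_of_inertia_fixes_root`: if the inertia group
`I_𝔓` fixes `a^{1/d}` then `d ∣ ord_w(a)`).  Here the complementary **totally ramified** case:
let `k` be a number field, `Ω/k` Galois, `w` a finite place of `k`, `𝔓` a prime of the integral
closure of `𝓞 k` in `Ω` above `w`, `n ≥ 1` an integer *not* in `w` (prime to the residue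
characteristic), `ζ ∈ Ω` a primitive `n`-th root of unity, `a ∈ k` a **uniformizer at `w`**
(`w.valuation k a = exp (-1)`) and `η ∈ Ω` with `ηⁿ = a`.  Then **for every `i` there is
`σ ∈ I_𝔓` with `σ η = ζⁱ η`**
(`Literature.NumberTheory.EllipticCurves.exists_mem_inertia_apply_eq_pow_mul_of_valuation_eq_exp`,
and its specialisation to `Ω = k̄`, `I_𝔓 ≤ Γ_k` in the conventions of `IntegralGaloisAction`):
the Kummer character `σ ↦ ση/η : I_𝔓 → μ_n` is onto — the finite-level content of
"`θ_n : I_t → μ_n` is surjective", i.e. "`k_w^{nr}(π^{1/n})/k_w^{nr}` is totally (tamely)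
ramified of degree `n`" (Serre, *Propriétés galoisiennes* (1972), §1.3–§1.5; Silverman *AEC*
VIII.1.6 for the unramified half).

Proof (as in `KummerUnramified`, at finite level).  `L = k(ζ, η) ⊆ Ω` is finite Galois over `k`
(the conjugates of `ζ` are powers of `ζ`, those of `η` are the `ζⁱ η`); `G = Gal(L/k)` acts on
`𝓞 L` with invariants `𝓞 k`; let `P = 𝔓 ∩ 𝓞 L` and `I = I_P(G)`.  (1) Every element of `I`
lifts to `I_𝔓` with the same action on `L` (profinite inertia lifting,
`GaloisRepresentations.exists_mul_mul_mem_inertia`).  (2) `#I = e(P ∣ w)` (Mathlib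
`Ideal.card_inertia_eq_ramificationIdxIn`).  (3) `n ∣ e(P ∣ w)`:
`ord_P(a) = e · ord_w(a) = -e` (`valuation_liesOver`) and `ord_P(a) = n · ord_P(η)`.  (4) The
elements of `I` fix `ζ` (`σζ ≡ ζ (mod P)` and distinct `n`-th roots of unity are distinct modulo
`P ∌ n`), so `σ ↦ σ η` is injective on `I` with values among the `n` elements `ζⁱ η`; by (2)–(3)
`#I ≥ n`, so it is a bijection onto `{ζⁱ η}`.

## References

* [Serre1972] J.-P. Serre, Invent. Math. 15 (1972), §1.3–§1.5 (tame inertia, `θ_d`).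
* [SilvermanAEC2009] J. H. Silverman, *The Arithmetic of Elliptic Curves*, 2nd ed.,
  Prop. VIII.1.6 and its proof.
* [SerreLocalFields1979] J.-P. Serre, *Local Fields*, Ch. I §7 Prop. 22, Ch. IV §2.
-/

noncomputable section

open scoped Pointwise IntermediateField NumberField

open NumberField IsDedekindDomain IntermediateField

universe u

namespace Literature.NumberTheory.EllipticCurves

/-! ## Roots of unity modulo a prime not containing `n` -/

/-- **Distinct `n`-th roots of unity are distinct modulo a prime ideal not containing `n`.**  In a
domain `R`, if `xⁿ = yⁿ = 1` and `x - y ∈ P` for a prime `P` with `n ∉ P`, then `x = y`: with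
`ρ = x y⁻¹` one has `(Σ_{i<n} ρⁱ)(ρ - 1) = ρⁿ - 1 = 0` and `Σ_{i<n} ρⁱ ≡ n (mod P)`.
[cite: Serre1972, §1.3] -/
theorem eq_of_pow_eq_one_of_sub_mem {R : Type*} [CommRing R] [IsDomain R] {P : Ideal R}
    [P.IsPrime] {n : ℕ} (hnP : (n : R) ∉ P) {x y : R} (hx : x ^ n = 1) (hy : y ^ n = 1)
    (hxy : x - y ∈ P) : x = y := by
  have hn0 : n ≠ 0 := by
    rintro rfl
    rw [Nat.cast_zero] at hnP
    exact hnP P.zero_mem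
  obtain ⟨u, rfl⟩ := IsUnit.of_pow_eq_one hy hn0
  set ρ : R := x * ↑u⁻¹ with hρ
  have hρn : ρ ^ n = 1 := by
    have hun : (↑(u ^ n) : R) = 1 := by rw [Units.val_pow_eq_pow_val, hy]
    have hun' : u ^ n = 1 := Units.val_eq_one.mp hun
    rw [hρ, mul_pow, hx, one_mul, ← Units.val_pow_eq_pow_val, inv_pow, hun', inv_one,
      Units.val_one]
  have hρ1 : ρ - 1 ∈ P := by
    have : ρ - 1 = (x - ↑u) * ↑u⁻¹ := by
      rw [hρ, sub_mul, Units.mul_inv]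
    rw [this]
    exact P.mul_mem_right _ hxy
  -- `Σ_{i<n} ρⁱ ≡ n (mod P)`
  have hgeom : (∑ i ∈ Finset.range n, ρ ^ i) - n ∈ P := by
    have : (∑ i ∈ Finset.range n, ρ ^ i) - n = ∑ i ∈ Finset.range n, (ρ ^ i - 1) := by
      rw [Finset.sum_sub_distrib, Finset.sum_const, Finset.card_range, nsmul_eq_mul, mul_one]
    rw [this]
    refine P.sum_mem fun i _ ↦ ?_
    have hdvd : ρ - 1 ∣ ρ ^ i - 1 := by
      have := sub_dvd_pow_sub_pow ρ 1 i
      rwa [one_pow] at this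
    exact Ideal.mem_of_dvd P hdvd hρ1
  -- `(Σ ρⁱ)(ρ - 1) = ρⁿ - 1 = 0`
  have hprod : (∑ i ∈ Finset.range n, ρ ^ i) * (ρ - 1) = 0 := by
    rw [geom_sum_mul, hρn, sub_self]
  rcases mul_eq_zero.mp hprod with hS | hρ0
  · exfalso
    apply hnP
    have : (n : R) = -((∑ i ∈ Finset.range n, ρ ^ i) - n) := by rw [hS, zero_sub, neg_neg]
    rw [this]
    exact P.neg_mem hgeom
  · rw [sub_eq_zero] at hρ0
    have : x = ρ * ↑u := by rw [hρ, mul_assoc, Units.inv_mul, mul_one]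
    rw [this, hρ0, one_mul]

section Conjugates

variable {k : Type u} [Field k] {Ω : Type u} [Field Ω] [Algebra k Ω]

/-- A `k`-automorphism of `Ω` sends a primitive `n`-th root of unity `ζ ∈ Ω` to a power of `ζ`.
[folklore] -/
theorem exists_algEquiv_apply_root_eq_pow {n : ℕ} (hn : 0 < n) {ζ : Ω} (hζ : IsPrimitiveRoot ζ n)
    (σ : Ω ≃ₐ[k] Ω) : ∃ j < n, σ ζ = ζ ^ j := by
  haveI : NeZero n := ⟨hn.ne'⟩
  have h1 : (σ ζ) ^ n = 1 := by rw [← map_pow, hζ.pow_eq_one, map_one]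
  obtain ⟨j, hj, hζj⟩ := hζ.eq_pow_of_pow_eq_one h1
  exact ⟨j, hj, hζj.symm⟩

/-- With `ζ ∈ Ω` a primitive `n`-th root of unity and `ηⁿ = a ∈ k^*`, every `k`-automorphism of
`Ω` sends `η` to some `ζⁱ η`. [folklore] -/
theorem exists_algEquiv_apply_eq_root_pow_mul {n : ℕ} (hn : 0 < n) {ζ : Ω}
    (hζ : IsPrimitiveRoot ζ n) {a : k} (ha : a ≠ 0) {η : Ω} (hη : η ^ n = algebraMap k Ω a)
    (σ : Ω ≃ₐ[k] Ω) : ∃ i < n, σ η = ζ ^ i * η := by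
  haveI : NeZero n := ⟨hn.ne'⟩
  have hη0 : η ≠ 0 := by
    rintro rfl
    rw [zero_pow hn.ne', eq_comm, map_eq_zero] at hη
    exact ha hη
  have h1 : (σ η / η) ^ n = 1 := by
    rw [div_pow, ← map_pow, hη, AlgEquiv.commutes, div_self]
    rw [← hη]
    exact pow_ne_zero _ hη0
  obtain ⟨i, hi, hζi⟩ := hζ.eq_pow_of_pow_eq_one h1
  exact ⟨i, hi, by rw [hζi, div_mul_cancel₀ _ hη0]⟩

/-- `k(ζ, η) ⊆ Ω` is normal over `k` when `ζ` is a primitive `n`-th root of unity and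
`ηⁿ ∈ k^*` (it contains all conjugates of its generators); `Ω/k` normal. [folklore] -/
theorem normal_adjoin_root_pair [Normal k Ω] {n : ℕ} (hn : 0 < n) {ζ : Ω}
    (hζ : IsPrimitiveRoot ζ n) {a : k} (ha : a ≠ 0) {η : Ω} (hη : η ^ n = algebraMap k Ω a) :
    Normal k (IntermediateField.adjoin k ({ζ, η} : Set Ω)) := by
  rw [IntermediateField.normal_iff_forall_map_le']
  intro σ
  rw [IntermediateField.adjoin_map, IntermediateField.adjoin_le_iff]
  rintro _ ⟨x, hx, rfl⟩
  have hζmem : ζ ∈ IntermediateField.adjoin k ({ζ, η} : Set Ω) :=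
    IntermediateField.subset_adjoin k _ (Set.mem_insert ζ {η})
  have hηmem : η ∈ IntermediateField.adjoin k ({ζ, η} : Set Ω) :=
    IntermediateField.subset_adjoin k _ (Set.mem_insert_of_mem ζ rfl)
  rcases hx with hx | hx
  · change σ x ∈ _
    rw [hx]
    obtain ⟨j, -, hj⟩ := exists_algEquiv_apply_root_eq_pow (k := k) hn hζ σ
    rw [hj]
    exact pow_mem hζmem j
  · rw [Set.mem_singleton_iff] at hx
    change σ x ∈ _
    rw [hx]
    obtain ⟨i, -, hi⟩ := exists_algEquiv_apply_eq_root_pow_mul hn hζ ha hη σ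
    rw [hi]
    exact mul_mem (pow_mem hζmem i) hηmem

/-- A `k`-automorphism of `k(S)` fixing every element of `S` is the identity. [folklore] -/
theorem algEquiv_adjoin_eq_one_of_forall_apply_eq {S : Set Ω}
    (g : IntermediateField.adjoin k S ≃ₐ[k] IntermediateField.adjoin k S)
    (hg : ∀ (s : Ω) (hs : s ∈ IntermediateField.adjoin k S), s ∈ S → (g ⟨s, hs⟩ : Ω) = s) :
    g = 1 := by
  have key : ∀ x : IntermediateField.adjoin k S, g x = x := by
    intro x
    have hx : (x : Ω) ∈ IntermediateField.adjoin k S := x.2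
    let F : IntermediateField k Ω :=
      { carrier := {y | ∃ hy : y ∈ IntermediateField.adjoin k S, (g ⟨y, hy⟩ : Ω) = y}
        mul_mem' := by
          rintro y z ⟨hy, hgy⟩ ⟨hz, hgz⟩
          refine ⟨mul_mem hy hz, ?_⟩
          have : (⟨y * z, mul_mem hy hz⟩ : IntermediateField.adjoin k S) = ⟨y, hy⟩ * ⟨z, hz⟩ :=
            rfl
          rw [this, map_mul]
          simp [hgy, hgz]
        one_mem' := ⟨one_mem _, by
          have : (⟨1, one_mem _⟩ : IntermediateField.adjoin k S) = 1 := rfl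
          rw [this, map_one]
          rfl⟩
        add_mem' := by
          rintro y z ⟨hy, hgy⟩ ⟨hz, hgz⟩
          refine ⟨add_mem hy hz, ?_⟩
          have : (⟨y + z, add_mem hy hz⟩ : IntermediateField.adjoin k S) = ⟨y, hy⟩ + ⟨z, hz⟩ :=
            rfl
          rw [this, map_add]
          simp [hgy, hgz]
        zero_mem' := ⟨zero_mem _, by
          have : (⟨0, zero_mem _⟩ : IntermediateField.adjoin k S) = 0 := rfl
          rw [this, map_zero]
          rfl⟩
        algebraMap_mem' := fun r ↦ ⟨IntermediateField.algebraMap_mem _ r, by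
          have : (⟨algebraMap k Ω r, IntermediateField.algebraMap_mem _ r⟩ :
              IntermediateField.adjoin k S) = algebraMap k (IntermediateField.adjoin k S) r := rfl
          rw [this, AlgEquiv.commutes]
          rfl⟩
        inv_mem' := by
          rintro y ⟨hy, hgy⟩
          refine ⟨inv_mem hy, ?_⟩
          have : (⟨y⁻¹, inv_mem hy⟩ : IntermediateField.adjoin k S) =
              (⟨y, hy⟩ : IntermediateField.adjoin k S)⁻¹ := rfl
          rw [this, map_inv₀]
          simp [hgy] }
    have hF : IntermediateField.adjoin k S ≤ F := by
      rw [IntermediateField.adjoin_le_iff]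
      intro s hs
      exact ⟨IntermediateField.subset_adjoin k S hs, hg s _ hs⟩
    obtain ⟨hx', hgx⟩ := hF hx
    exact Subtype.ext hgx
  ext x
  exact congrArg Subtype.val (key x)

end Conjugates

section NumberField

variable {k : Type u} [Field k] [NumberField k] {Ω : Type u} [Field Ω] [Algebra k Ω] [IsGalois k Ω]

/-- **The Kummer character of a uniformizer is onto `μ_n` on the inertia group.**  Let `k` be a
number field, `Ω/k` Galois, `w` a finite place of `k`, `𝔓` a prime of the integral closure `B`
of `𝓞 k` in `Ω` above `w`; let `n ≥ 1` with `n ∉ w`, `ζ ∈ Ω` a primitive `n`-th root of unity,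
`a ∈ k` a uniformizer at `w` (`w.valuation k a = exp (-1)`) and `η ∈ Ω` with `ηⁿ = a`.  Then for
every `i` some `σ ∈ I_𝔓 ≤ Gal(Ω/k)` has `σ η = ζⁱ η`.  See the module docstring.
[cite: Serre1972, §1.3–§1.5] [cite: SilvermanAEC2009, Prop. VIII.1.6 (proof)] -/
theorem exists_mem_inertia_apply_eq_pow_mul_of_valuation_eq_exp {n : ℕ} (hn : 0 < n) {ζ : Ω}
    (hζ : IsPrimitiveRoot ζ n) (w : HeightOneSpectrum (𝓞 k)) (hnw : (n : 𝓞 k) ∉ w.asIdeal)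
    {a : k} (ha : w.valuation k a = WithZero.exp (-1 : ℤ)) {η : Ω}
    (hη : η ^ n = algebraMap k Ω a) (𝔓 : Ideal (integralClosure (𝓞 k) Ω)) [𝔓.IsPrime]
    [𝔓.LiesOver w.asIdeal] (i : ℕ) :
    ∃ σ : Ω ≃ₐ[k] Ω, σ ∈ 𝔓.inertia (Ω ≃ₐ[k] Ω) ∧ σ η = ζ ^ i * η := by
  classical
  haveI : NeZero n := ⟨hn.ne'⟩
  have ha0 : a ≠ 0 := by
    intro h0
    rw [h0, map_zero] at ha
    exact WithZero.coe_ne_zero ha.symm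
  have hη0 : η ≠ 0 := by
    rintro rfl
    rw [zero_pow hn.ne', eq_comm, map_eq_zero] at hη
    exact ha0 hη
  -- ### the finite Galois extension `L = k(ζ, η)` and its arithmetic
  set L : IntermediateField k Ω := IntermediateField.adjoin k ({ζ, η} : Set Ω) with hLdef
  have hζint : IsIntegral k ζ :=
    IsIntegral.of_pow hn (by rw [hζ.pow_eq_one]; exact isIntegral_one)
  have hηint : IsIntegral k η := by
    refine IsIntegral.of_pow hn ?_
    rw [hη]
    exact isIntegral_algebraMap
  haveI : FiniteDimensional k L := by
    refine IntermediateField.finiteDimensional_adjoin fun x hx ↦ ?_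
    rcases hx with rfl | hx
    · exact hζint
    · rw [Set.mem_singleton_iff] at hx
      rw [hx]
      exact hηint
  haveI : Normal k L := normal_adjoin_root_pair hn hζ ha0 hη
  haveI : IsGalois k L := ⟨⟩
  haveI : NumberField L := NumberField.of_module_finite k L
  haveI : Module.Finite (𝓞 k) (𝓞 L) := IsIntegralClosure.finite (𝓞 k) k L (𝓞 L)
  haveI : IsGaloisGroup (L ≃ₐ[k] L) (𝓞 k) (𝓞 L) :=
    IsGaloisGroup.of_isFractionRing (L ≃ₐ[k] L) (𝓞 k) (𝓞 L) k L
  set G := L ≃ₐ[k] L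
  have hζL : ζ ∈ L := IntermediateField.subset_adjoin k _ (Set.mem_insert ζ {η})
  have hηL : η ∈ L := IntermediateField.subset_adjoin k _ (Set.mem_insert_of_mem ζ rfl)
  set ζ' : L := ⟨ζ, hζL⟩ with hζ'def
  set η' : L := ⟨η, hηL⟩ with hη'def
  have hζ' : IsPrimitiveRoot ζ' n :=
    IsPrimitiveRoot.of_map_of_injective (f := algebraMap L Ω)
      (show IsPrimitiveRoot (algebraMap L Ω ζ') n from hζ) (algebraMap L Ω).injective
  have hη'0 : η' ≠ 0 := fun h ↦ hη0 (congrArg Subtype.val h)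
  have hη'n : η' ^ n = algebraMap k L a := by
    apply (algebraMap L Ω).injective
    rw [map_pow, ← IsScalarTower.algebraMap_apply, ← hη]
    rfl
  have hζ'int : IsIntegral ℤ ζ' :=
    IsIntegral.of_pow hn (by rw [hζ'.pow_eq_one]; exact isIntegral_one)
  -- ### the prime `P = 𝔓 ∩ 𝓞 L` below `𝔓`
  set ι := ringOfIntegersToIntegralClosure (k := k) (Ω := Ω) L with hιdef
  set P : Ideal (𝓞 L) := 𝔓.comap ι with hPdef
  haveI hPprime : P.IsPrime := Ideal.comap_isPrime ι 𝔓
  haveI hPover : P.LiesOver w.asIdeal := by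
    constructor
    change w.asIdeal = Ideal.comap (algebraMap (𝓞 k) (𝓞 L)) (Ideal.comap ι 𝔓)
    rw [Ideal.comap_comap, hιdef, ringOfIntegersToIntegralClosure_comp_algebraMap]
    exact Ideal.LiesOver.over
  have hPne : P ≠ ⊥ := Ideal.ne_bot_of_liesOver_of_ne_bot w.ne_bot P
  let wP : HeightOneSpectrum (𝓞 L) := ⟨P, hPprime, hPne⟩
  haveI : wP.asIdeal.LiesOver w.asIdeal := hPover
  set I : Subgroup G := P.inertia G with hIdef
  -- ### Step 1: every element of `I` lifts to `I_𝔓` with the same action on `L`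
  have hlift : ∀ g ∈ I, ∃ σ : Ω ≃ₐ[k] Ω, σ ∈ 𝔓.inertia (Ω ≃ₐ[k] Ω) ∧
      ∀ x : L, σ (x : Ω) = (g x : Ω) := by
    intro g hg
    rw [hIdef, Ideal.inertia, AddSubgroup.mem_inertia] at hg
    -- profinite set-up for `Gal(Ω/k)` acting on `B`
    letI : TopologicalSpace (integralClosure (𝓞 k) Ω) := ⊥
    haveI : DiscreteTopology (integralClosure (𝓞 k) Ω) := ⟨rfl⟩
    haveI : ContinuousSMul (Ω ≃ₐ[k] Ω) (integralClosure (𝓞 k) Ω) :=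
      continuousSMul_iff_stabilizer_isOpen.mpr
        (Literature.NumberTheory.GaloisRepresentations.stabilizer_integralClosure_isOpen (𝓞 k))
    let N : Subgroup (Ω ≃ₐ[k] Ω) := L.fixingSubgroup
    have hN : IsClosed (N : Set (Ω ≃ₐ[k] Ω)) := IntermediateField.fixingSubgroup_isClosed L
    -- lift `g` to `Ω`
    let g₀ : Ω ≃ₐ[k] Ω := AlgEquiv.liftNormal g Ω
    have hg₀ : ∀ x : L, g₀ (x : Ω) = (g x : Ω) := fun x ↦ AlgEquiv.liftNormal_commutes g Ω x
    -- `g₀` acts as inertia on the `N`-invariants of `B`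
    have hg₀inv : ∀ b : integralClosure (𝓞 k) Ω, (∀ m ∈ N, m • b = b) → g₀ • b - b ∈ 𝔓 := by
      intro b hb
      have hbL : (b : Ω) ∈ L := by
        rw [← InfiniteGalois.fixedField_fixingSubgroup L, IntermediateField.mem_fixedField_iff]
        intro f hf
        have := congrArg Subtype.val (hb f hf)
        rwa [integralClosure.coe_smul] at this
      have hbint : IsIntegral ℤ (⟨(b : Ω), hbL⟩ : L) := by
        rw [← isIntegral_algebraMap_iff (algebraMap L Ω).injective]
        exact isIntegral_trans (R := ℤ) (A := 𝓞 k) (b : Ω) b.2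
      set x : 𝓞 L := ⟨⟨(b : Ω), hbL⟩, hbint⟩ with hxdef
      have hbx : b = ι x := Subtype.ext rfl
      have hgx : g • x - x ∈ P := hg x
      rw [hPdef, Ideal.mem_comap, map_sub] at hgx
      rw [hbx]
      convert hgx using 2
      apply Subtype.ext
      rw [integralClosure.coe_smul, coe_ringOfIntegersToIntegralClosure,
        coe_ringOfIntegersToIntegralClosure]
      exact hg₀ x
    obtain ⟨m₁, hm₁, m₂, hm₂, hσ⟩ :=
      GaloisRepresentations.exists_mul_mul_mem_inertia N hN 𝔓 g₀ hg₀inv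
    refine ⟨m₁ * g₀ * m₂, hσ, fun x ↦ ?_⟩
    have hm₂x : m₂ (x : Ω) = x := (IntermediateField.mem_fixingSubgroup_iff _ _).mp hm₂ _ x.2
    have hm₁x : m₁ (g₀ (x : Ω)) = g₀ x := by
      rw [hg₀]
      exact (IntermediateField.mem_fixingSubgroup_iff _ _).mp hm₁ _ (g x).2
    rw [AlgEquiv.mul_apply, AlgEquiv.mul_apply, hm₂x, hm₁x, hg₀]
  -- ### Step 2: `#I = e(P ∣ w)`
  have hcardI : Nat.card I = w.asIdeal.ramificationIdx' P := by
    haveI := w.isPrime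
    rw [Ideal.ramificationIdx'_eq_ramificationIdx w.asIdeal P w.ne_bot,
      ← Ideal.ramificationIdxIn_eq_ramificationIdx w.asIdeal P G,
      ← Ideal.card_inertia_eq_ramificationIdxIn (G := G) w.asIdeal P]
  have he0 : w.asIdeal.ramificationIdx' P ≠ 0 := by
    rw [← hcardI]
    exact Nat.card_pos.ne'
  -- ### Step 3: `n ∣ e(P ∣ w)`
  have hdvd : n ∣ w.asIdeal.ramificationIdx' P := by
    have hval := HeightOneSpectrum.valuation_liesOver L w wP a
    rw [ha, ← hη'n, map_pow] at hval
    have hlog := congrArg WithZero.log hval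
    rw [WithZero.log_pow, WithZero.log_pow, WithZero.log_exp, smul_neg, nsmul_eq_mul, mul_one,
      nsmul_eq_mul] at hlog
    have : (n : ℤ) ∣ (w.asIdeal.ramificationIdx' P : ℤ) := by
      rw [← dvd_neg, hlog]
      exact Dvd.intro _ rfl
    exact Int.natCast_dvd_natCast.mp this
  -- ### Step 4: the elements of `I` fix `ζ'`
  have hnP' : ((n : ℕ) : 𝓞 L) ∉ P := by
    intro h
    apply hnw
    have h' : algebraMap (𝓞 k) (𝓞 L) (n : 𝓞 k) ∈ P := by rwa [map_natCast]
    rw [← Ideal.mem_comap] at h'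
    have hover : w.asIdeal = P.comap (algebraMap (𝓞 k) (𝓞 L)) := hPover.over
    rw [hover]
    exact h'
  have hfixζ : ∀ g ∈ I, (g : G) ζ' = ζ' := by
    intro g hg
    rw [hIdef, Ideal.inertia, AddSubgroup.mem_inertia] at hg
    set z : 𝓞 L := ⟨ζ', hζ'int⟩ with hzdef
    have hz1 : z ^ n = 1 := by
      apply RingOfIntegers.ext
      change algebraMap (𝓞 L) L (z ^ n) = algebraMap (𝓞 L) L 1
      rw [map_pow, map_one]
      exact hζ'.pow_eq_one
    have hgz1 : (g • z) ^ n = 1 := by rw [← smul_pow', hz1, smul_one]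
    have h1 : g • z - z ∈ P := hg z
    have h2 := eq_of_pow_eq_one_of_sub_mem (P := P) hnP' hgz1 hz1 h1
    exact congrArg (fun t : 𝓞 L ↦ (t : L)) h2
  -- the Kummer map `g ↦ g η'` on `I`
  let F : I → L := fun g ↦ (g : G) η'
  have hFmem : ∀ g : I, ∃ j < n, F g = ζ' ^ j * η' := fun g ↦
    exists_algEquiv_apply_eq_root_pow_mul hn hζ' ha0 hη'n (g : G)
  have hFinj : Function.Injective F := by
    intro g₁ g₂ h12
    change (g₁ : G) η' = (g₂ : G) η' at h12
    have hmem : (g₂ : G)⁻¹ * (g₁ : G) ∈ I := I.mul_mem (I.inv_mem g₂.2) g₁.2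
    have hfix : ∀ (s : Ω) (hs : s ∈ L), s ∈ ({ζ, η} : Set Ω) →
        (((((g₂ : G)⁻¹ * (g₁ : G)) ⟨s, hs⟩ : L)) : Ω) = s := by
      intro s hs hs'
      have key : ∀ t : L, (t : Ω) ∈ ({ζ, η} : Set Ω) →
          ((((g₂ : G)⁻¹ * (g₁ : G)) t : L) : Ω) = t := by
        rintro ⟨t, ht⟩ ht'
        rcases ht' with ht' | ht'
        · have e : (⟨t, ht⟩ : L) = ζ' := Subtype.ext ht'
          rw [e]
          exact congrArg Subtype.val (hfixζ _ hmem)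
        · rw [Set.mem_singleton_iff] at ht'
          have e : (⟨t, ht⟩ : L) = η' := Subtype.ext ht'
          rw [e, AlgEquiv.mul_apply, h12, AlgEquiv.aut_inv, AlgEquiv.symm_apply_apply]
      exact key ⟨s, hs⟩ hs'
    have h1 := algEquiv_adjoin_eq_one_of_forall_apply_eq ((g₂ : G)⁻¹ * (g₁ : G)) hfix
    exact Subtype.ext (inv_mul_eq_one.mp h1).symm
  -- counting: `F` is a bijection of `I` onto the `n` elements `ζ'ʲ η'`
  let T : Finset L := (Finset.range n).image fun j ↦ ζ' ^ j * η'
  have hT : ∀ g : I, F g ∈ T := fun g ↦ by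
    obtain ⟨j, hj, hFj⟩ := hFmem g
    exact Finset.mem_image.mpr ⟨j, Finset.mem_range.mpr hj, hFj.symm⟩
  let F' : I → T := fun g ↦ ⟨F g, hT g⟩
  have hF'inj : Function.Injective F' := fun g₁ g₂ h ↦ hFinj (congrArg Subtype.val h)
  have hcardT : Nat.card T ≤ n := by
    rw [Nat.card_eq_finsetCard]
    exact Finset.card_image_le.trans (Finset.card_range n).le
  have hn_le : n ≤ Nat.card I := by
    rw [hcardI]
    exact Nat.le_of_dvd (Nat.pos_of_ne_zero he0) hdvd
  have hbij : Function.Bijective F' := hF'inj.bijective_of_nat_card_le (hcardT.trans hn_le)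
  -- the element `ζ^i η` is hit
  have hi' : ζ' ^ (i % n) * η' ∈ T :=
    Finset.mem_image.mpr ⟨i % n, Finset.mem_range.mpr (Nat.mod_lt i hn), rfl⟩
  obtain ⟨g, hg⟩ := hbij.2 ⟨_, hi'⟩
  have hgη : (g : G) η' = ζ' ^ (i % n) * η' := congrArg Subtype.val hg
  obtain ⟨σ, hσI, hσ⟩ := hlift g g.2
  refine ⟨σ, hσI, ?_⟩
  have hpow : ζ ^ i = ζ ^ (i % n) := by
    conv_lhs => rw [← Nat.mod_add_div i n, pow_add, pow_mul, hζ.pow_eq_one, one_pow, mul_one]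
  rw [hpow]
  have := hσ η'
  rw [hgη] at this
  exact this

/-- **Specialisation to the absolute Galois group** (`Ω = k̄`, `\bar ℤ_k = absIntegers (𝓞 k) k`,
`𝔓 ∈ w.primesAbove`, `I_𝔓 ≤ Γ_k`, the conventions of `IntegralGaloisAction`): for a uniformizer
`a` at `w`, `ηⁿ = a`, `ζ ∈ k̄` a primitive `n`-th root of unity, `n ∉ w`, every `ζⁱ η` is `σ • η`
for some `σ ∈ I_𝔓`. [cite: Serre1972, §1.3–§1.5] -/
theorem exists_mem_absoluteGaloisGroup_inertia_smul_eq_pow_mul {n : ℕ} (hn : 0 < n)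
    {ζ : AlgebraicClosure k} (hζ : IsPrimitiveRoot ζ n) (w : HeightOneSpectrum (𝓞 k))
    (hnw : (n : 𝓞 k) ∉ w.asIdeal) {a : k} (ha : w.valuation k a = WithZero.exp (-1 : ℤ))
    {η : AlgebraicClosure k} (hη : η ^ n = algebraMap k (AlgebraicClosure k) a)
    {𝔓 : Ideal (GaloisRepresentations.absIntegers (𝓞 k) k)} (h𝔓 : 𝔓 ∈ w.primesAbove) (i : ℕ) :
    ∃ σ : Field.absoluteGaloisGroup k, σ ∈ 𝔓.inertia (Field.absoluteGaloisGroup k) ∧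
      σ • η = ζ ^ i * η :=
  @exists_mem_inertia_apply_eq_pow_mul_of_valuation_eq_exp k _ _ (AlgebraicClosure k) _ _ _ n hn
    ζ hζ w hnw a ha η hη 𝔓 h𝔓.1 h𝔓.2 i

end NumberField

end Literature.NumberTheory.EllipticCurves

end
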